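import Summits.CriticalPhenomena.PercolationContinuityZ3.Theorems.PercNearOneGluingNoHeavyLowerTailSahiThreeChainSlotIdentification

/-!
# Sahi's `C₃` in dimension three, III-b: THE SLOT POSITIVITY — `T(1_U,1_V,1_W) ≥ 0` for all down-sets of `[3]³` (from the kernel certificate)

Support file of the one-cut programme (crux `NoHeavyLowerTail`, stmt-CriticalPhenomena-4575; cell `prim-masterthm`, seat P3, gen 17;
`run/shared/lean/prim/prim-masterthm/prim-masterthm-p3/HIERARCHY.md` §25; memo `run/shared/lean/prim/prim-masterthm/FROM-prim-masterthm-p3-g17-THREE-CHAINS-C3.md`).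

Removes the symmetry reduction of the certificate `SahiThreeChain.slotPhi_nonneg_canon` (`…SlotCertificate`: `U` canonical under the six COORDINATE permutations,
`U ≤ V ≤ W`) and the bit-mask encoding (`…SlotIdentification`: `slotPhi = TZ`, `(TZ : ℝ) = T` on cell sets):
* `TZ_swap₁₂`, `TZ_swap₂₃` — `TZ` is symmetric in its three arguments; `T_comp_equiv` — `T` is invariant under every relabelling of the cells preserving the
  non-attacking relation; `cellPerm s` (the six coordinate permutations), `testBit_permMask` / `permMask_mem` / `permMask_comp` (the certificate's `permMask`
  acts on the `980` down-set masks as the coordinate permutations, closed under composition — `native_decide` over the list), `TZ_permMask` (axis invariance);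
* **`TZ_nonneg_of_mem`** — `0 ≤ TZ a b c` for ALL `a, b, c ∈ dsList` (pick the coordinate permutation and the member minimising the mask: it is canonical and below
  the other two);
* coverage: `enc U = Σ_{z∈U} 2^{code z}`, `cellSet_enc`, height functions (`heightOf`, `eq_filter_heightOf`, `antitoneB_heightOf`), `maskOfHeight_mem` (every antitone
  height function's mask is in `dsList` — the two enumerations of the `980` plane partitions agree, one `native_decide`), `enc_mem_dsList`;
* **`SahiThreeChain.slotPos`** — for all down-sets `U, V, W : Finset P`: `0 ≤ T (setInd U) (setInd V) (setInd W)` — the hypothesis `hpos` of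
  `…SahiThreeChainOrderThree`, now a theorem; with it `…OrderThree` gives Sahi's `C₃` in dimension three unconditionally.
HONEST LABEL: proved; rests on `native_decide` evaluations (the 58 205 888-triple certificate and small finite tables; axiom `Lean.ofReduceBool`; proposed
`--computational`); otherwise standard axioms. [this work]
-/

namespace Summit.CriticalPhenomena.PercolationContinuityZ3.Theorems

namespace SahiThreeChain

open Finset Function
open Literature.Combinatorics.Sahi2008

/-! ### Symmetries of the integer slot form -/

/-- `TZ` is symmetric in its first two arguments. [this work] -/
theorem TZ_swap₁₂ (U V W : ℕ) : TZ U V W = TZ V U W := by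
  unfold TZ
  have h1 : ∑ z : P, bit U (code z) * bit V (code z) * bit W (code z) = ∑ z : P, bit V (code z) * bit U (code z) * bit W (code z) :=
    Fintype.sum_congr _ _ fun z => by ring
  have h2 : ∑ z : P, ∑ z' : P, nz z z' * (bit U (code z) * bit V (code z) * bit W (code z') +
      bit U (code z) * bit W (code z) * bit V (code z') + bit V (code z) * bit W (code z) * bit U (code z')) =
      ∑ z : P, ∑ z' : P, nz z z' * (bit V (code z) * bit U (code z) * bit W (code z') +
      bit V (code z) * bit W (code z) * bit U (code z') + bit U (code z) * bit W (code z) * bit V (code z')) :=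
    Fintype.sum_congr _ _ fun z => Fintype.sum_congr _ _ fun z' => by ring
  have h3 : ∑ z : P, ∑ z' : P, ∑ z'' : P, nz z z' * nz z z'' * nz z' z'' * (bit U (code z) * bit V (code z') * bit W (code z'')) =
      ∑ z : P, ∑ z' : P, ∑ z'' : P, nz z z' * nz z z'' * nz z' z'' * (bit V (code z) * bit U (code z') * bit W (code z'')) := by
    rw [Finset.sum_comm]
    exact Fintype.sum_congr _ _ fun z => Fintype.sum_congr _ _ fun z' => Fintype.sum_congr _ _ fun z'' => by
      rw [nz_comm z' z]; ring
  rw [h1, h2, h3]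

/-- `TZ` is symmetric in its last two arguments. [this work] -/
theorem TZ_swap₂₃ (U V W : ℕ) : TZ U V W = TZ U W V := by
  unfold TZ
  have h1 : ∑ z : P, bit U (code z) * bit V (code z) * bit W (code z) = ∑ z : P, bit U (code z) * bit W (code z) * bit V (code z) :=
    Fintype.sum_congr _ _ fun z => by ring
  have h2 : ∑ z : P, ∑ z' : P, nz z z' * (bit U (code z) * bit V (code z) * bit W (code z') +
      bit U (code z) * bit W (code z) * bit V (code z') + bit V (code z) * bit W (code z) * bit U (code z')) =
      ∑ z : P, ∑ z' : P, nz z z' * (bit U (code z) * bit W (code z) * bit V (code z') +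
      bit U (code z) * bit V (code z) * bit W (code z') + bit W (code z) * bit V (code z) * bit U (code z')) :=
    Fintype.sum_congr _ _ fun z => Fintype.sum_congr _ _ fun z' => by ring
  have h3 : ∑ z : P, ∑ z' : P, ∑ z'' : P, nz z z' * nz z z'' * nz z' z'' * (bit U (code z) * bit V (code z') * bit W (code z'')) =
      ∑ z : P, ∑ z' : P, ∑ z'' : P, nz z z' * nz z z'' * nz z' z'' * (bit U (code z) * bit W (code z') * bit V (code z'')) := by
    refine Fintype.sum_congr _ _ fun z => ?_
    rw [Finset.sum_comm]
    exact Fintype.sum_congr _ _ fun z' => Fintype.sum_congr _ _ fun z'' => by rw [nz_comm z'' z']; ring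
  rw [h1, h2, h3]

/-! ### Invariance of `T` under coordinate permutations of the slot grid -/

/-- `T` is invariant under any relabelling of the cells preserving the non-attacking relation. [this work] -/
theorem T_comp_equiv (e : P ≃ P) (he : ∀ z z', NonAtt (e z) (e z') ↔ NonAtt z z') (f g h : P → ℝ) :
    T (f ∘ e) (g ∘ e) (h ∘ e) = T f g h := by
  have hnw : ∀ z z', nw (e z) (e z') = nw z z' := fun z z' => by unfold nw; exact if_congr (he z z') rfl rfl
  have h1 : (∑ z, f z * g z * h z) = ∑ z, (f ∘ e) z * (g ∘ e) z * (h ∘ e) z :=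
    (Equiv.sum_comp e (fun z => f z * g z * h z)).symm
  have h2 : (∑ z, ∑ z', nw z z' * (f z * g z * h z' + f z * h z * g z' + g z * h z * f z')) =
      ∑ z, ∑ z', nw z z' * ((f ∘ e) z * (g ∘ e) z * (h ∘ e) z' + (f ∘ e) z * (h ∘ e) z * (g ∘ e) z' +
        (g ∘ e) z * (h ∘ e) z * (f ∘ e) z') := by
    rw [← Equiv.sum_comp e]
    refine Fintype.sum_congr _ _ fun z => ?_
    rw [← Equiv.sum_comp e]
    refine Fintype.sum_congr _ _ fun z' => ?_
    rw [hnw]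
    rfl
  have h3 : (∑ z, ∑ z', ∑ z'', nw z z' * nw z z'' * nw z' z'' * (f z * g z' * h z'')) =
      ∑ z, ∑ z', ∑ z'', nw z z' * nw z z'' * nw z' z'' * ((f ∘ e) z * (g ∘ e) z' * (h ∘ e) z'') := by
    rw [← Equiv.sum_comp e]
    refine Fintype.sum_congr _ _ fun z => ?_
    rw [← Equiv.sum_comp e]
    refine Fintype.sum_congr _ _ fun z' => ?_
    rw [← Equiv.sum_comp e]
    refine Fintype.sum_congr _ _ fun z'' => ?_
    rw [hnw, hnw, hnw]
    rfl
  unfold T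
  rw [h1, h2, h3]

/-- The six coordinate permutations of the slot grid, numbered as `permCell` (`0` = identity, `1` = swap the last two axes, …). [this work] -/
def cellPerm (s : Fin 6) (z : P) : P :=
  match s with
  | ⟨0, _⟩ => z
  | ⟨1, _⟩ => (z.1, z.2.2, z.2.1)
  | ⟨2, _⟩ => (z.2.1, z.1, z.2.2)
  | ⟨3, _⟩ => (z.2.1, z.2.2, z.1)
  | ⟨4, _⟩ => (z.2.2, z.1, z.2.1)
  | ⟨5, _⟩ => (z.2.2, z.2.1, z.1)

/-- Each coordinate permutation is a bijection of the cells. [this work] -/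
theorem cellPerm_bijective (s : Fin 6) : Function.Bijective (cellPerm s) := by
  revert s
  decide

/-- Coordinate permutations preserve the non-attacking relation. [this work] -/
theorem nonAtt_cellPerm (s : Fin 6) (z z' : P) : NonAtt (cellPerm s z) (cellPerm s z') ↔ NonAtt z z' := by
  revert s z z'
  decide

/-- The coordinate permutation as an equivalence. [this work] -/
noncomputable def cellPermEquiv (s : Fin 6) : P ≃ P := Equiv.ofBijective (cellPerm s) (cellPerm_bijective s)

/-- **The certificate's `permMask` acts on the cell sets of down-set masks by the coordinate permutation** (checked on the `980` masks). [this work] -/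
theorem testBit_permMask (s : Fin 6) : ∀ m ∈ dsList, ∀ z : P, Nat.testBit (permMask s m) (code (cellPerm s z)) = Nat.testBit m (code z) := by
  revert s
  native_decide

/-- `permMask` preserves the list of down-set masks. [this work] -/
theorem permMask_mem (s : Fin 6) : ∀ m ∈ dsList, permMask s m ∈ dsList := by
  revert s
  native_decide

/-- The six `permMask` are closed under composition on the down-set masks. [this work] -/
theorem permMask_comp (t s : Fin 6) : ∃ u : Fin 6, ∀ m ∈ dsList, permMask t (permMask s m) = permMask u m := by
  revert t s
  native_decide

/-- The indicator of the cell set of a permuted mask is the indicator of the cell set, relabelled. [this work] -/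
theorem setInd_cellSet_permMask (s : Fin 6) {m : ℕ} (hm : m ∈ dsList) :
    setInd (cellSet (permMask s m)) = setInd (cellSet m) ∘ (cellPermEquiv s).symm := by
  funext w
  obtain ⟨z, rfl⟩ := (cellPerm_bijective s).2 w
  have hz : (cellPermEquiv s).symm (cellPerm s z) = z := by
    apply (cellPermEquiv s).injective
    rw [Equiv.apply_symm_apply]
    rfl
  simp only [Function.comp_apply, hz, setInd_apply, cellSet, Finset.mem_filter, Finset.mem_univ, true_and,
    testBit_permMask s m hm z]

/-- **Axis invariance of `TZ` on down-set masks.** [this work] -/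
theorem TZ_permMask (s : Fin 6) {a b c : ℕ} (ha : a ∈ dsList) (hb : b ∈ dsList) (hc : c ∈ dsList) :
    TZ (permMask s a) (permMask s b) (permMask s c) = TZ a b c := by
  have h : (TZ (permMask s a) (permMask s b) (permMask s c) : ℝ) = TZ a b c := by
    rw [TZ_cast, TZ_cast, setInd_cellSet_permMask s ha, setInd_cellSet_permMask s hb, setInd_cellSet_permMask s hc]
    exact T_comp_equiv (cellPermEquiv s).symm (fun z z' => by
      have := nonAtt_cellPerm s ((cellPermEquiv s).symm z) ((cellPermEquiv s).symm z')
      have e1 : cellPerm s ((cellPermEquiv s).symm z) = z := (cellPermEquiv s).apply_symm_apply z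
      have e2 : cellPerm s ((cellPermEquiv s).symm z') = z' := (cellPermEquiv s).apply_symm_apply z'
      rw [e1, e2] at this
      exact this.symm) _ _ _
  exact_mod_cast h

/-! ### Removing the symmetry reduction: `TZ ≥ 0` on all triples of down-set masks -/

/-- **`TZ ≥ 0` for every three members of `dsList`** (from the canonical/sorted certificate by the two symmetries). [this work] -/
theorem TZ_nonneg_of_mem {a b c : ℕ} (ha : a ∈ dsList) (hb : b ∈ dsList) (hc : c ∈ dsList) : 0 ≤ TZ a b c := by
  -- the candidate values `permMask s x`, `s < 6`, `x ∈ {a,b,c}`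
  set C : Finset ℕ := ((Finset.univ : Finset (Fin 6)) ×ˢ ({a, b, c} : Finset ℕ)).image fun p => permMask p.1 p.2 with hC
  have hCne : C.Nonempty := ⟨permMask 0 a, by rw [hC]; exact Finset.mem_image.2 ⟨(0, a), by simp, rfl⟩⟩
  obtain ⟨p, hp, hpmin⟩ := Finset.mem_image.1 (Finset.min'_mem C hCne)
  set s := p.1 with hs
  set x := p.2 with hx
  have hxmem : x ∈ ({a, b, c} : Finset ℕ) := (Finset.mem_product.1 hp).2
  have hx_ds : x ∈ dsList := by
    simp only [Finset.mem_insert, Finset.mem_singleton] at hxmem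
    rcases hxmem with h | h | h <;> rw [h] <;> assumption
  have hmin : ∀ t : Fin 6, ∀ y ∈ ({a, b, c} : Finset ℕ), permMask s x ≤ permMask t y := by
    intro t y hy
    rw [hpmin]
    exact Finset.min'_le C _ (Finset.mem_image.2 ⟨(t, y), Finset.mem_product.2 ⟨Finset.mem_univ _, hy⟩, rfl⟩)
  -- the minimiser is canonical
  have hcan : isCanon (permMask s x) = true := by
    unfold isCanon
    simp only [List.all_eq_true, List.mem_range, decide_eq_true_eq]
    intro t ht
    obtain ⟨u, hu⟩ := permMask_comp ⟨t, ht⟩ s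
    rw [show permMask t (permMask s x) = permMask (⟨t, ht⟩ : Fin 6) (permMask s x) from rfl, hu x hx_ds]
    exact hmin u x hxmem
  have hsx : permMask s x ∈ dsList := permMask_mem s x hx_ds
  -- the images of the three masks
  have hA := permMask_mem s a ha
  have hB := permMask_mem s b hb
  have hCc := permMask_mem s c hc
  have key : ∀ y w : ℕ, y ∈ ({a, b, c} : Finset ℕ) → w ∈ ({a, b, c} : Finset ℕ) → permMask s y ∈ dsList → permMask s w ∈ dsList →
      0 ≤ TZ (permMask s x) (permMask s y) (permMask s w) := by
    intro y w hy hw hyd hwd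
    rcases le_total (permMask s y) (permMask s w) with hle | hle
    · have := slotPhi_nonneg_canon _ hsx _ hyd _ hwd hcan (hmin s y hy) hle
      rwa [slotPhi_eq_TZ] at this
    · have := slotPhi_nonneg_canon _ hsx _ hwd _ hyd hcan (hmin s w hw) hle
      rw [slotPhi_eq_TZ] at this
      rwa [TZ_swap₂₃]
  have ma : a ∈ ({a, b, c} : Finset ℕ) := by simp
  have mb : b ∈ ({a, b, c} : Finset ℕ) := by simp
  have mc : c ∈ ({a, b, c} : Finset ℕ) := by simp
  rw [← TZ_permMask s ha hb hc]
  simp only [Finset.mem_insert, Finset.mem_singleton] at hxmem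
  rcases hxmem with h | h | h
  · rw [h] at key
    exact key b c mb mc hB hCc
  · rw [h] at key
    rw [TZ_swap₁₂]
    exact key a c ma mc hA hCc
  · rw [h] at key
    rw [TZ_swap₂₃, TZ_swap₁₂]
    exact key a b ma mb hA hB

/-! ### Coverage: every down-set of the slot grid is the cell set of a member of `dsList` -/

/-- The mask of a set of cells. [this work] -/
def enc (U : Finset P) : ℕ := ∑ z ∈ U, 2 ^ code z

/-- `code` as an embedding. [this work] -/
def codeEmb : P ↪ ℕ := ⟨code, fun _ _ h => codeEquiv.injective (Fin.ext h)⟩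

/-- The bits of the mask of `U` are the membership in `U`. [this work] -/
theorem testBit_enc (U : Finset P) (z : P) : Nat.testBit (enc U) (code z) = true ↔ z ∈ U := by
  have henc : enc U = ∑ j ∈ U.map codeEmb, 2 ^ j := by
    unfold enc; rw [Finset.sum_map]; rfl
  rw [henc, ← Nat.mem_bitIndices, ← List.mem_toFinset, Finset.toFinset_bitIndices_sum_two_pow]
  exact Finset.mem_map' codeEmb

/-- Decoding the encoding. [this work] -/
theorem cellSet_enc (U : Finset P) : cellSet (enc U) = U := by
  ext z
  simp only [cellSet, Finset.mem_filter, Finset.mem_univ, true_and, testBit_enc]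

/-- The mask of the down-set below an (antitone) height function `h : [3]² → {0,…,3}`. [this work] -/
def maskOfHeight (h : Fin 3 → Fin 3 → Fin 4) : ℕ := enc (univ.filter fun z : P => z.2.2.val < (h z.1 z.2.1).val)

/-- Antitone height functions (Boolean test). [this work] -/
def antitoneB (h : Fin 3 → Fin 3 → Fin 4) : Bool :=
  decide (∀ x y x' y' : Fin 3, x ≤ x' → y ≤ y' → h x' y' ≤ h x y)

/-- Every antitone height function gives a member of the certificate's `dsList` (the two enumerations of the `980` down-sets agree; one
`native_decide`). [this work] -/
theorem maskOfHeight_mem : ∀ h : Fin 3 → Fin 3 → Fin 4, antitoneB h = true → maskOfHeight h ∈ dsList := by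
  native_decide

/-- In the chain `Fin 3`, a down-set is an initial segment of length its cardinality. [this work] -/
theorem mem_iff_lt_card_of_lower (S : Finset (Fin 3)) (hS : ∀ a ∈ S, ∀ b : Fin 3, b ≤ a → b ∈ S) (u : Fin 3) :
    u ∈ S ↔ u.val < S.card := by
  revert hS u S
  decide

/-- The height function of a set of cells: the number of cells above `(x,y)`. [this work] -/
def heightOf (U : Finset P) (x y : Fin 3) : Fin 4 :=
  ⟨(univ.filter fun u : Fin 3 => (x, y, u) ∈ U).card,
    Nat.lt_succ_of_le ((Finset.card_le_univ _).trans (by simp))⟩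

/-- A down-set of the slot grid is the set of cells below its height function. [this work] -/
theorem eq_filter_heightOf {U : Finset P} (hU : IsLowerSet ((U : Finset P) : Set P)) :
    U = univ.filter fun z : P => z.2.2.val < (heightOf U z.1 z.2.1).val := by
  ext z
  simp only [Finset.mem_filter, Finset.mem_univ, true_and, heightOf]
  have hS : ∀ a ∈ (univ.filter fun u : Fin 3 => (z.1, z.2.1, u) ∈ U), ∀ b : Fin 3, b ≤ a →
      b ∈ (univ.filter fun u : Fin 3 => (z.1, z.2.1, u) ∈ U) := by
    intro a ha b hba
    simp only [Finset.mem_filter, Finset.mem_univ, true_and] at ha ⊢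
    exact hU (show ((z.1, z.2.1, b) : P) ≤ (z.1, z.2.1, a) from ⟨le_rfl, le_rfl, hba⟩) ha
  have h := mem_iff_lt_card_of_lower _ hS z.2.2
  simp only [Finset.mem_filter, Finset.mem_univ, true_and] at h
  exact h

/-- The height function of a down-set is antitone. [this work] -/
theorem antitoneB_heightOf {U : Finset P} (hU : IsLowerSet ((U : Finset P) : Set P)) : antitoneB (heightOf U) = true := by
  unfold antitoneB
  rw [decide_eq_true_eq]
  intro x y x' y' hx hy
  change (univ.filter fun u : Fin 3 => (x', y', u) ∈ U).card ≤ (univ.filter fun u : Fin 3 => (x, y, u) ∈ U).card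
  refine Finset.card_le_card fun u hu => ?_
  simp only [Finset.mem_filter, Finset.mem_univ, true_and] at hu ⊢
  exact hU (show ((x, y, u) : P) ≤ (x', y', u) from ⟨hx, hy, le_rfl⟩) hu

/-- **Coverage**: the mask of every down-set of `[3]³` is in `dsList`. [this work] -/
theorem enc_mem_dsList {U : Finset P} (hU : IsLowerSet ((U : Finset P) : Set P)) : enc U ∈ dsList := by
  have h := maskOfHeight_mem (heightOf U) (antitoneB_heightOf hU)
  unfold maskOfHeight at h
  rwa [← eq_filter_heightOf hU] at h

/-! ### The slot positivity -/

/-- **THE SLOT POSITIVITY (unconditional).**  For all down-sets `U, V, W` of the `3×3×3` slot grid, `T(1_U, 1_V, 1_W) ≥ 0` — the hypothesis `hpos` of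
`…SahiThreeChainOrderThree`, discharged by the kernel certificate `slotPhi_nonneg_canon` through the identification `slotPhi = T` and the two symmetries. [this work] -/
theorem slotPos (U V W : Finset P) (hU : IsLowerSet ((U : Finset P) : Set P)) (hV : IsLowerSet ((V : Finset P) : Set P))
    (hW : IsLowerSet ((W : Finset P) : Set P)) : 0 ≤ T (setInd U) (setInd V) (setInd W) := by
  rw [← cellSet_enc U, ← cellSet_enc V, ← cellSet_enc W, ← TZ_cast]
  exact_mod_cast TZ_nonneg_of_mem (enc_mem_dsList hU) (enc_mem_dsList hV) (enc_mem_dsList hW)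

end SahiThreeChain

end Summit.CriticalPhenomena.PercolationContinuityZ3.Theorems
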